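import Mathlib

/-!
# Two empty shapes of the three-prime cell (lifting the exponent)

Support for the birth stub `stub_threePP_rest` of `ZooSorting` (stmt-ABC-24024,
`route-ABC-ThreeSlotCyclotomicDescent`): when two of the exponents of `p^x + q^y = r^z` share an odd
prime factor `ℓ`, the triple reads `A^ℓ + B^ℓ = r^z` or `R^ℓ − A^ℓ = q^y`, and

* `pow_add_pow_ne_prime_pow`: `A^ℓ + B^ℓ` (`A, B ≥ 2` coprime, `ℓ` an odd prime) is never a prime
  power `r^z`;
* `pow_sub_pow_ne_prime_pow`: `R^ℓ − A^ℓ` (`1 ≤ A < R` coprime, `ℓ` an odd prime) is never a prime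
  power `q^y` with `q ∣ R − A`.

Both by the lifting-the-exponent lemma (Mathlib `Nat.emultiplicity_pow_add_pow`,
`Nat.emultiplicity_pow_sub_pow`, and `emultiplicity_pow_sub_pow_of_prime` at `2`): the valuation of the
right-hand side at the prime is at most `v(A ± B) + 1`, while its size exceeds `(A ± B)^2`.
(The remaining case `q ∤ R − A`, i.e. `R = A + 1`, is the consecutive-base family of the route.)
-/

namespace Summit.ABC.ABC.Theorems.ThreeSlotLTEEmpty

/-- `emultiplicity r ℓ ≤ 1` for primes `r, ℓ`. -/
theorem emultiplicity_prime_prime_le_one {r ℓ : ℕ} (hr : r.Prime) (hl : ℓ.Prime) :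
    emultiplicity r ℓ ≤ 1 := by
  by_cases h : r ∣ ℓ
  · have : r = ℓ := (Nat.prime_dvd_prime_iff_eq hr hl).mp h
    subst this
    have := emultiplicity_pow_self_of_prime hr.prime 1
    rw [pow_one] at this
    rw [this]
    exact le_of_eq (by norm_cast)
  · rw [emultiplicity_eq_zero.mpr h]
    exact zero_le_one

/-- From `(z : ℕ∞) = j + e` with `e ≤ 1`: `z ≤ j + 1`. -/
theorem le_add_one_of_enat {z j : ℕ} {e : ℕ∞} (h : (z : ℕ∞) = j + e) (he : e ≤ 1) : z ≤ j + 1 := by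
  have : (z : ℕ∞) ≤ (j : ℕ∞) + 1 := by rw [h]; exact add_le_add_right he _
  exact_mod_cast this

/-- In a coprime pair with even sum both members are odd. -/
theorem odd_of_coprime_of_two_dvd_add {A B : ℕ} (hcop : Nat.Coprime A B) (h : 2 ∣ A + B) :
    Odd A ∧ Odd B := by
  rcases Nat.even_or_odd A with hA | hA <;> rcases Nat.even_or_odd B with hB | hB
  · exact absurd (Nat.eq_one_of_dvd_coprimes hcop (even_iff_two_dvd.mp hA) (even_iff_two_dvd.mp hB))
      (by norm_num)
  · exfalso
    have : Odd (A + B) := Even.add_odd hA hB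
    exact this.not_two_dvd_nat h
  · exfalso
    have : Odd (A + B) := Odd.add_even hA hB
    exact this.not_two_dvd_nat h
  · exact ⟨hA, hB⟩

/-- **`A^ℓ + B^ℓ` is not a prime power** for `A, B ≥ 2` coprime and `ℓ` an odd prime.
[folklore; lifting the exponent] -/
theorem pow_add_pow_ne_prime_pow {A B r ℓ : ℕ} (hr : r.Prime) (hl : ℓ.Prime) (hl2 : ℓ ≠ 2)
    (hA : 2 ≤ A) (hB : 2 ≤ B) (hcop : Nat.Coprime A B) (z : ℕ) : A ^ ℓ + B ^ ℓ ≠ r ^ z := by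
  intro h
  have hlodd : Odd ℓ := hl.eq_two_or_odd'.resolve_left hl2
  have hl3 : 3 ≤ ℓ := by have := hl.two_le; omega
  -- `A + B = r^j`, `j ≥ 1`
  have hdvd : A + B ∣ r ^ z := h ▸ Odd.nat_add_dvd_pow_add_pow A B hlodd
  obtain ⟨j, -, hAB⟩ := (Nat.dvd_prime_pow hr).mp hdvd
  have hj1 : 1 ≤ j := by
    by_contra hj0
    have : j = 0 := by omega
    subst this
    simp at hAB
    omega
  -- size: `(A+B)^2 < A^ℓ + B^ℓ = r^z`, so `2j < z`
  have hsize : (A + B) ^ 2 < A ^ ℓ + B ^ ℓ := by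
    have hA3 : A ^ 3 ≤ A ^ ℓ := Nat.pow_le_pow_right (by omega) hl3
    have hB3 : B ^ 3 ≤ B ^ ℓ := Nat.pow_le_pow_right (by omega) hl3
    have hne : ¬ (A = 2 ∧ B = 2) := by
      rintro ⟨rfl, rfl⟩
      norm_num at hcop
    have key : (A + B) ^ 2 < A ^ 3 + B ^ 3 := by
      rcases le_total A B with hle | hle
      · have hB3' : 3 ≤ B := by
          by_contra hB3'
          exact hne ⟨by omega, by omega⟩
        nlinarith [Nat.mul_le_mul_left (A ^ 2) hA, Nat.mul_le_mul_left (B ^ 2) hB3',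
          Nat.mul_le_mul hle hle]
      · have hA3' : 3 ≤ A := by
          by_contra hA3'
          exact hne ⟨by omega, by omega⟩
        nlinarith [Nat.mul_le_mul_left (B ^ 2) hB, Nat.mul_le_mul_left (A ^ 2) hA3',
          Nat.mul_le_mul hle hle]
    omega
  have h2j : 2 * j < z := by
    by_contra hz
    have : r ^ z ≤ r ^ (2 * j) := Nat.pow_le_pow_right hr.pos (by omega)
    rw [mul_comm, pow_mul, ← hAB, ← h] at this
    omega
  -- LTE: `z ≤ j + 1`
  rcases hr.eq_two_or_odd' with rfl | hrodd
  · -- `r = 2`: `A, B` odd and `v₂(A^ℓ + B^ℓ) = v₂(A + B)`, i.e. `z = j`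
    obtain ⟨hAo, -⟩ := odd_of_coprime_of_two_dvd_add hcop (hAB ▸ dvd_pow_self 2 (by omega))
    have key := emultiplicity_pow_sub_pow_of_prime Int.prime_two (x := (A : ℤ)) (y := -(B : ℤ))
      (n := ℓ) (by rw [sub_neg_eq_add]; exact_mod_cast (hAB ▸ dvd_pow_self 2 (by omega) : 2 ∣ A + B))
      (by exact_mod_cast hAo.not_two_dvd_nat) (by exact_mod_cast hlodd.not_two_dvd_nat)
    rw [Odd.neg_pow hlodd, sub_neg_eq_add, sub_neg_eq_add] at key
    have e1 : ((A : ℤ) ^ ℓ + (B : ℤ) ^ ℓ) = (2 : ℤ) ^ z := by exact_mod_cast h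
    have e2 : ((A : ℤ) + B) = (2 : ℤ) ^ j := by exact_mod_cast hAB
    rw [e1, e2, emultiplicity_pow_self_of_prime Int.prime_two,
      emultiplicity_pow_self_of_prime Int.prime_two] at key
    have : z = j := by exact_mod_cast key
    omega
  · -- `r` odd: `v_r(A^ℓ + B^ℓ) = v_r(A + B) + v_r(ℓ) ≤ j + 1`
    have hrAB : r ∣ A + B := hAB ▸ dvd_pow_self r (by omega)
    have hrA : ¬ r ∣ A := by
      intro hrA
      have hrB : r ∣ B := (Nat.dvd_add_right hrA).mp hrAB
      exact hr.one_lt.ne' (Nat.eq_one_of_dvd_coprimes hcop hrA hrB)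
    have key := Nat.emultiplicity_pow_add_pow hr hrodd hrAB hrA hlodd
    rw [h, hAB, emultiplicity_pow_self_of_prime hr.prime, emultiplicity_pow_self_of_prime hr.prime]
      at key
    have := le_add_one_of_enat key (emultiplicity_prime_prime_le_one hr hl)
    omega

/-- **`R^ℓ − A^ℓ` is not a prime power `q^y` with `q ∣ R − A`**, for `1 ≤ A < R` coprime and `ℓ` an
odd prime. [folklore; lifting the exponent] -/
theorem pow_sub_pow_ne_prime_pow {R A q ℓ : ℕ} (hq : q.Prime) (hl : ℓ.Prime) (hl2 : ℓ ≠ 2)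
    (hA : 1 ≤ A) (hAR : A < R) (hcop : Nat.Coprime R A) (hqd : q ∣ R - A) (y : ℕ) :
    R ^ ℓ - A ^ ℓ ≠ q ^ y := by
  intro h
  have hlodd : Odd ℓ := hl.eq_two_or_odd'.resolve_left hl2
  have hl3 : 3 ≤ ℓ := by have := hl.two_le; omega
  -- `R - A = q^j`, `j ≥ 1`
  have hdvd : R - A ∣ q ^ y := h ▸ Nat.sub_dvd_pow_sub_pow R A ℓ
  obtain ⟨j, -, hRA⟩ := (Nat.dvd_prime_pow hq).mp hdvd
  have hj1 : 1 ≤ j := by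
    by_contra hj0
    have : j = 0 := by omega
    subst this
    rw [pow_zero] at hRA
    rw [hRA] at hqd
    exact hq.one_lt.ne' (Nat.dvd_one.mp hqd)
  -- size: `(R - A)^2 < R^ℓ - A^ℓ = q^y`, so `2j < y`
  have hsize : (R - A) ^ 2 < R ^ ℓ - A ^ ℓ := by
    obtain ⟨d, rfl⟩ := Nat.exists_eq_add_of_lt hAR
    set X := (A + d + 1) ^ (ℓ - 1) with hX
    have hl1 : ℓ = (ℓ - 1) + 1 := by omega
    have h1 : A ^ ℓ ≤ A * X := by
      calc A ^ ℓ = A * A ^ (ℓ - 1) := by rw [← pow_succ', ← hl1]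
        _ ≤ A * X := Nat.mul_le_mul_left _ (Nat.pow_le_pow_left (by omega) _)
    have h2 : (A + d + 1) ^ ℓ = (A + d + 1) * X := by rw [← pow_succ', ← hl1]
    have h3 : A + d + 1 ≤ X := by rw [hX]; exact Nat.le_self_pow (by omega) _
    have h4 := Nat.mul_le_mul_left (d + 1) h3
    have e : A + d + 1 - A = d + 1 := by omega
    rw [e, h2]
    have h5 : (d + 1) ^ 2 + A * X < (A + d + 1) * X := by nlinarith
    exact Nat.lt_sub_iff_add_lt.mpr (lt_of_le_of_lt (Nat.add_le_add_left h1 _) h5)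
  have h2j : 2 * j < y := by
    by_contra hy
    have : q ^ y ≤ q ^ (2 * j) := Nat.pow_le_pow_right hq.pos (by omega)
    rw [mul_comm, pow_mul, ← hRA, ← h] at this
    omega
  -- `q ∤ R`
  have hqR : ¬ q ∣ R := by
    intro hqR
    have hqA : q ∣ A := by
      have : q ∣ R - (R - A) := Nat.dvd_sub hqR hqd
      rwa [Nat.sub_sub_self hAR.le] at this
    exact hq.one_lt.ne' (Nat.eq_one_of_dvd_coprimes hcop hqR hqA)
  rcases hq.eq_two_or_odd' with rfl | hqodd
  · -- `q = 2`: `R, A` odd and `v₂(R^ℓ - A^ℓ) = v₂(R - A)`, i.e. `y = j`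
    have hRo : Odd R := by
      rcases Nat.even_or_odd R with hRe | hRo
      · exact absurd (even_iff_two_dvd.mp hRe) hqR
      · exact hRo
    have hd' : (2 : ℤ) ∣ (R : ℤ) - (A : ℤ) := by
      have := hqd
      rw [← Int.natCast_dvd_natCast, Nat.cast_sub hAR.le] at this
      exact_mod_cast this
    have key := emultiplicity_pow_sub_pow_of_prime Int.prime_two (x := (R : ℤ)) (y := (A : ℤ))
      (n := ℓ) hd' (by exact_mod_cast hRo.not_two_dvd_nat) (by exact_mod_cast hlodd.not_two_dvd_nat)
    have e1 : ((R : ℤ) ^ ℓ - (A : ℤ) ^ ℓ) = (2 : ℤ) ^ y := by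
      have := congrArg (Nat.cast : ℕ → ℤ) h
      rw [Nat.cast_sub (Nat.pow_le_pow_left hAR.le ℓ)] at this
      exact_mod_cast this
    have e2 : ((R : ℤ) - A) = (2 : ℤ) ^ j := by
      have := congrArg (Nat.cast : ℕ → ℤ) hRA
      rw [Nat.cast_sub hAR.le] at this
      exact_mod_cast this
    rw [e1, e2, emultiplicity_pow_self_of_prime Int.prime_two,
      emultiplicity_pow_self_of_prime Int.prime_two] at key
    have : y = j := by exact_mod_cast key
    omega
  · -- `q` odd: `v_q(R^ℓ - A^ℓ) = v_q(R - A) + v_q(ℓ) ≤ j + 1`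
    have key := Nat.emultiplicity_pow_sub_pow hq hqodd hqd hqR ℓ
    rw [h, hRA, emultiplicity_pow_self_of_prime hq.prime, emultiplicity_pow_self_of_prime hq.prime]
      at key
    have := le_add_one_of_enat key (emultiplicity_prime_prime_le_one hq hl)
    omega

end Summit.ABC.ABC.Theorems.ThreeSlotLTEEmpty
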